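import Mathlib
import HarnessLib
import Literature.Analysis.FluidPDE.WholeSpaceIBPEnstrophy
import Literature.Analysis.FluidPDE.DistributionalPressurePoisson
import Summits.NavierStokesRegularity.NavierStokesRegularity.Theorems.TypeIQuarterGateScarEnvelopeTypeIForcedTsaiSectorReductionRadial

/-!
# ARM B — SO(3)-SECTOR IDENTITIES, file 2: the POLOIDAL SPLIT `curl(g(σ)·(∇P × y))`
  (ns-wall-extremal, eng-2 lineage g3, 2026-08-29)

Companion of `…ForcedTsaiSectorReductionRadial` (file 1: the linearised Leray velocity/vorticity
operators on radial × harmonic sectors, local hypotheses).  Here: the curl of the toroidal sector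
field of a `C²` positively `J`-homogeneous harmonic `P : ℝ³ → ℝ` with a radial profile `g`
differentiable at `σ = ‖x‖²`:

* `fderiv_gradient_apply_self` : Euler for the gradient, `D(∇P)(x)[x] = (J−1)∇P(x)`;
* `inner_self_gradient_of_homogeneous` : `⟪x, ∇P(x)⟫ = J·P(x)`;
* `curl_toroidal` : `curl(∇P × y) = (J+1)∇P` (tree `curl_cross_apply`, `divergence_gradient`,
  `divergence_fun_id_eq_finrank`);
* `gradient_comp_norm_sq` : `∇(g(‖·‖²))(x) = 2g′(σ) x`;
* ★ `curl_radial_smul_toroidal` :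
  `curl(g(σ)·(∇P × y))(x) = ((J+1)g(σ) + 2σg′(σ))·∇P(x) − (2J g′(σ) P(x))·x`
  — LINEAR-FLOOR §2 / LFD-CERT §2b: the curl of a degree-`J` toroidal («swirl») field splits into
  the `ℓ = J−1` vector harmonic `∇P` and (after regrouping `P·y − σ∇P/(2J+1)`) the `ℓ = J+1` one, both
  radial components tied to ONE profile; in `r` (`χ(r) = g(r²)`, `rχ′ = 2σg′`, `χ′/r = 2g′`):
  `curl(χ·(∇P × y)) = ((J+1)χ + rχ′)∇P − J(χ′/r)P·y` — eng-1's
  `curl(χ(y×∇P)) = −[(J+1)χ + ((J+1)/(2J+1))rχ′]∇P + J(χ′/r)[Py − r²∇P/(2J+1)]` up to the sign of the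
  convention (`∇P × y = −(y × ∇P)`) and the regrouping.  This is the identity behind the decoupling
  lemma (LFD-CERT §2b: `κ_pol(J) ≥ min(κ(J−1), κ(J+1))`), whose `L²` part stays paper;
* `laplacian_poloidalCompanion` : the `ℓ = J+1` piece is a harmonic vector field,
  `Δ(P·y − (2J+1)⁻¹σ·∇P) = 0` (file 1's `laplacian_smul_id`, `laplacian_radial_smul`; tree
  `laplacian_gradient`).

`curl ∘ L = A ∘ curl` and the residual split `g = Aω + curl((U·∇)U)` are eng-1 g7's
`…ForcedTsaiIsometryInvariance` (`curl_linearisedLeray`, `lerayVorticityResidual_eq_vorticityForm`,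
p701926) — imported by name where needed, not restated.  PRIOR ART: the AGL helper
`RungBlowupCofinal/SolidHarmonicProfileOperator.lean` (C^∞ three-lift calculus of the velocity
operator); no curl-of-lift identity was found there (`lean search curl … Lift`).  MEANING:
identity-grade (★ information), pointwise, LINEAR kinematics; excludes nothing; ⟨23843⟩/H3 OPEN;
NS regularity NOT proved.
-/

noncomputable section

set_option linter.dupNamespace false

namespace Summit.NavierStokesRegularity.NavierStokesRegularity.Cruxes.ScarEnvelopeTypeI.ForcedTsai

namespace Sector

open scoped Laplacian RealInnerProductSpace InnerProductSpace ContDiff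
open Literature.Analysis.FluidPDE Literature.Analysis.PDE Set Filter Topology

/-! ## `ℝ³`: the POLOIDAL split — curl of the toroidal sector field -/

section Poloidal

/-- **Euler's identity for the gradient**: `D(∇P)(x)[x] = (J−1) • ∇P(x)` for a `C²` positively
`J`-homogeneous `P`. -/
theorem fderiv_gradient_apply_self {P : E3 → ℝ} (hP : ContDiff ℝ 2 P) {J : ℕ}
    (hhom : ∀ t : ℝ, 0 < t → ∀ y : E3, P (t • y) = t ^ J * P y) (x : E3) :
    fderiv ℝ (gradient P) x x = ((J : ℝ) - 1) • gradient P x := by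
  have hPd : Differentiable ℝ P := hP.differentiable (by norm_num)
  have hd : DifferentiableAt ℝ (gradient P) x :=
    (contDiff_gradient_of_succ (n := 1) (by exact_mod_cast hP)).differentiable one_ne_zero x
  have h := fderiv_apply_self_of_homogeneous (U := gradient P) (y := x) ((J : ℤ) - 1)
    (fun t ht => gradient_homogeneous hPd hhom ht x) hd
  simpa using h

/-- **Euler's identity for `P`**: `⟪x, ∇P(x)⟫ = DP(x)[x] = J · P(x)`. -/
theorem inner_self_gradient_of_homogeneous {P : E3 → ℝ} (hP : Differentiable ℝ P) {J : ℕ}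
    (hhom : ∀ t : ℝ, 0 < t → ∀ y : E3, P (t • y) = t ^ J * P y) (x : E3) :
    ⟪x, gradient P x⟫ = J * P x := by
  have h := fderiv_apply_self_of_homogeneous (U := P) (y := x) (J : ℤ)
    (fun t ht => by rw [hhom t ht x, zpow_natCast, smul_eq_mul]) (hP x)
  rw [real_inner_comm, inner_gradient_left, h, smul_eq_mul]
  push_cast
  ring

/-- **`curl (∇P × y) = (J+1) ∇P`** for a `C²` positively `J`-homogeneous harmonic `P`
(`curl (W × Ω) = (Ω·∇)W − (div W)Ω + (div Ω)W − (W·∇)Ω` with `W = ∇P`, `Ω = y`: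
`(J−1)∇P − ΔP·y + 3∇P − ∇P`). -/
theorem curl_toroidal {P : E3 → ℝ} (hP : ContDiff ℝ 2 P) {J : ℕ}
    (hhom : ∀ t : ℝ, 0 < t → ∀ y : E3, P (t • y) = t ^ J * P y) (hΔP : ∀ y, (Δ P) y = 0) (x : E3) :
    curl (fun y : E3 => cross (gradient P y) y) x = ((J : ℝ) + 1) • gradient P x := by
  have hd : DifferentiableAt ℝ (gradient P) x :=
    (contDiff_gradient_of_succ (n := 1) (by exact_mod_cast hP)).differentiable one_ne_zero x
  have hid : DifferentiableAt ℝ (fun y : E3 => y) x := differentiableAt_id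
  rw [curl_cross_apply hd hid, fderiv_gradient_apply_self hP hhom x, divergence_gradient hP x, hΔP,
    zero_smul, sub_zero, divergence_fun_id_eq_finrank, finrank_euclideanSpace_fin, fderiv_fun_id,
    ContinuousLinearMap.id_apply]
  push_cast
  module

/-- The gradient of a radial function: `∇(g(‖·‖²))(x) = 2 g′(‖x‖²) x`. -/
theorem gradient_comp_norm_sq {g : ℝ → ℝ} {g₁ : ℝ} {x : E3} (hg : HasDerivAt g g₁ (‖x‖ ^ 2)) :
    gradient (fun y : E3 => g (‖y‖ ^ 2)) x = (2 * g₁) • x := by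
  refine gradient_eq_of_hasFDerivAt_innerSL ?_
  have h := hasFDerivAt_comp_norm_sq (E := E3) hg
  rwa [← map_smul] at h

/-- ★ **POLOIDAL SPLIT (LINEAR-FLOOR §2, LFD-CERT §2b): the curl of the toroidal sector field**
`U(y) = g(‖y‖²) • (∇P(y) × y)` of a `C²` positively `J`-homogeneous harmonic `P`:
`curl U(x) = ((J+1) g(σ) + 2σ g′(σ)) • ∇P(x) − (2J g′(σ) P(x)) • x`, `σ = ‖x‖²`
— the `ℓ = J − 1` vector harmonic `∇P` and (after regrouping `P y − σ∇P/(2J+1)`) the `ℓ = J + 1`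
one; in `r`, `χ(r) = g(r²)` (`rχ′ = 2σg′`): `curl(χ · (∇P × y)) = ((J+1)χ + rχ′)∇P − J(χ′/r) P y`,
eng-1's formula for `curl(χ (y × ∇P))` up to the sign of the convention.  This is the identity that
ties the two radial components `u_a, u_b` of a swirl-sector field to ONE profile `χ`
(decoupling lemma LFD-CERT §2b). -/
theorem curl_radial_smul_toroidal {P : E3 → ℝ} (hP : ContDiff ℝ 2 P) {J : ℕ}
    (hhom : ∀ t : ℝ, 0 < t → ∀ y : E3, P (t • y) = t ^ J * P y) (hΔP : ∀ y, (Δ P) y = 0)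
    {g : ℝ → ℝ} {g₁ : ℝ} {x : E3} (hg : HasDerivAt g g₁ (‖x‖ ^ 2)) :
    curl (fun y : E3 => g (‖y‖ ^ 2) • cross (gradient P y) y) x
      = (((J : ℝ) + 1) * g (‖x‖ ^ 2) + 2 * ‖x‖ ^ 2 * g₁) • gradient P x
        - (2 * J * g₁ * P x) • x := by
  have hPd : Differentiable ℝ P := hP.differentiable (by norm_num)
  have hφ : DifferentiableAt ℝ (fun y : E3 => g (‖y‖ ^ 2)) x :=
    (hasFDerivAt_comp_norm_sq (E := E3) hg).differentiableAt
  have hΦ : DifferentiableAt ℝ (fun y : E3 => cross (gradient P y) y) x :=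
    ((contDiff_toroidal (n := 1) (by exact_mod_cast hP)).differentiable one_ne_zero).differentiableAt
  rw [curl_smul hφ hΦ, curl_toroidal hP hhom hΔP x, fderiv_eq_innerSL_gradient,
    curlCLM_smulRight_innerSL, gradient_comp_norm_sq hg, cross_smul_left, cross_cross_right,
    real_inner_self_eq_norm_sq, inner_self_gradient_of_homogeneous hPd hhom x, smul_sub, smul_smul,
    smul_smul, smul_smul]
  module

/-- **The `ℓ = J+1` piece of the split is a harmonic vector field**: for a `C³` positively
`J`-homogeneous harmonic `P`, `Δ(P·y − (2J+1)⁻¹ σ·∇P) = 0` (`Δ(P y) = 2∇P` from file 1,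
`Δ(σ ∇P) = (4J+2)∇P` by `laplacian_radial_smul` with Euler degree `J−1` for `∇P`, and `Δ∇P = ∇ΔP = 0`). -/
theorem laplacian_poloidalCompanion {P : E3 → ℝ} (hP : ContDiff ℝ 3 P) {J : ℕ}
    (hhom : ∀ t : ℝ, 0 < t → ∀ y : E3, P (t • y) = t ^ J * P y) (hΔP : ∀ y, (Δ P) y = 0) (x : E3) :
    (Δ (fun y : E3 => P y • y - ((2 * (J : ℝ) + 1)⁻¹ * ‖y‖ ^ 2) • gradient P y)) x = 0 := by
  have hP2 : ContDiff ℝ 2 P := hP.of_le (by norm_num)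
  have hG2 : ContDiff ℝ 2 (gradient P) := contDiff_gradient_of_succ (n := 2) (by exact_mod_cast hP)
  set c : ℝ := (2 * (J : ℝ) + 1)⁻¹ with hc
  -- the two summands are `C²` at `x`
  have h1 : ContDiffAt ℝ 2 (fun y : E3 => P y • y) x := (hP2.smul contDiff_id).contDiffAt
  have hg : ContDiffOn ℝ 2 (fun σ : ℝ => c * σ) Set.univ := (contDiff_const.mul contDiff_id).contDiffOn
  have h2 : ContDiffAt ℝ 2 (fun y : E3 => (c * ‖y‖ ^ 2) • gradient P y) x :=
    (contDiffAt_comp_norm_sq (E := E3) isOpen_univ hg (Set.mem_univ _)).smul hG2.contDiffAt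
  rw [show (fun y : E3 => P y • y - (c * ‖y‖ ^ 2) • gradient P y)
      = (fun y : E3 => P y • y) - fun y : E3 => (c * ‖y‖ ^ 2) • gradient P y from rfl,
    ContDiffAt.laplacian_sub h1 h2]
  -- `Δ(P y) = 2∇P`
  rw [congrFun (laplacian_smul_id hP2 hΔP) x]
  -- `Δ((c σ) ∇P) = (4J+2) c ∇P`
  have hE : fderiv ℝ (gradient P) x x = ((J : ℝ) - 1) • gradient P x := fderiv_gradient_apply_self hP2 hhom x
  have hΔG : (Δ (gradient P)) x = 0 := by
    rw [laplacian_gradient hP x, show (Δ P) = fun _ => (0 : ℝ) from funext hΔP]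
    simp [gradient]
  rw [laplacian_radial_smul (E := E3) isOpen_univ hg (Set.mem_univ _) hG2.contDiffAt hE, hΔG, smul_zero,
    zero_add, finrank_euclideanSpace_fin]
  have hd1 : deriv (fun σ : ℝ => c * σ) = fun _ => c := by
    funext σ
    have h : HasDerivAt (fun σ : ℝ => c * σ) (c * 1) σ := (hasDerivAt_id σ).const_mul c
    rw [h.deriv, mul_one]
  have hd2 : deriv (deriv (fun σ : ℝ => c * σ)) (‖x‖ ^ 2) = 0 := by rw [hd1, deriv_const]
  rw [hd2, congrFun hd1 (‖x‖ ^ 2), ← sub_smul]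
  -- scalar: 2 - (0 + (2·3 + 4(J-1))·c) = 0
  have : (2 : ℝ) - (4 * ‖x‖ ^ 2 * 0 + (2 * ((3 : ℕ) : ℝ) + 4 * ((J : ℝ) - 1)) * c) = 0 := by
    rw [hc]; push_cast; field_simp; ring
  rw [this, zero_smul]

end Poloidal

end Sector

end Summit.NavierStokesRegularity.NavierStokesRegularity.Cruxes.ScarEnvelopeTypeI.ForcedTsai

end
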